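import Summits.AtomisticToContinuum.Crystallization.Theorems.ChessboardParticlePlanesLjPlaneChessboardCrossKernelFourier

/-!
# Crux `ChessboardParticlePlanes.LjPlaneChessboard` (stmt-AtomisticToContinuum-6709), line `Sketch`,
# stub `fourier_ljCrossKernel_bound` — exponential decay of the planar Fourier transform of the
# cross-plane Lennard-Jones kernel

For a `2`-dimensional real inner-product space `V` and a vertical offset `ζ > 0`, the planar
Fourier transform of the cross-plane kernel `K_ζ(v) = V_LJ(√(‖v‖² + ζ²))` decays exponentially:
`‖𝓕[K_ζ](w)‖ ≤ C(ζ) e^{-πζ‖w‖}` for all `w ∈ V`.  This is the summability input (over the dual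
lattice) for the lattice-form positivity argument of the chessboard estimate.

Route (tree + Mathlib only): by the Laplace form
`𝓕[K_ζ](w) = -2π ∫_{λ > q} W(q, λ) e^{-λζ} dλ`, `q = 2π‖w‖` (`fourier_ljCrossKernel`), the
domination `|W(q, λ)| ≤ λ³/144 + λ⁹/43545600` for `0 ≤ q ≤ λ` (`abs_sliceWeight_le`) and the
splitting `e^{-λζ} = e^{-λζ/2} e^{-λζ/2} ≤ e^{-λζ/2} e^{-qζ/2}` on `λ > q`,
`|∫_{λ > q} W(q, λ) e^{-λζ} dλ| ≤ e^{-qζ/2} ∫₀^∞ (λ³/144 + λ⁹/43545600) e^{-λζ/2} dλ`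
(enlarging `(q, ∞)` to `(0, ∞)` for the non-negative dominating integrand, integrable by Euler's
integral `integrableOn_pow_mul_exp_neg_mul_Ioi`), and `e^{-qζ/2} = e^{-πζ‖w‖}`.

Main results:
* `integrableOn_sliceDominant_mul_exp` : integrability of `(λ³/144 + λ⁹/43545600) e^{-λr}` on
  `(q, ∞)`, `q ≥ 0`, `r > 0`;
* `norm_integral_sliceWeight_mul_exp_le` : the Laplace-side decay estimate;
* `fourier_ljCrossKernel_bound` : the registered stub.
[folklore]
-/

noncomputable section

namespace Summit.AtomisticToContinuum.Crystallization.Theorems.ChessboardParticlePlanesLjPlaneChessboard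

open Literature.MathematicalPhysics.StatisticalMechanics MeasureTheory Set
open scoped Real InnerProductSpace FourierTransform

/-! ## The Laplace-side decay estimate -/

/-- The dominating Euler integrand `(λ³/144 + λ⁹/43545600) e^{-λr}` is integrable on `(q, ∞)`
for `q ≥ 0` and `r > 0` (Euler's integral on `(0, ∞) ⊇ (q, ∞)`). [folklore] -/
theorem integrableOn_sliceDominant_mul_exp {q r : ℝ} (hq : 0 ≤ q) (hr : 0 < r) :
    IntegrableOn (fun l : ℝ => (l ^ 3 / 144 + l ^ 9 / 43545600) * Real.exp (-(l * r)))
      (Ioi q) := by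
  have hsum : IntegrableOn (fun l : ℝ => 1 / 144 * (l ^ 3 * Real.exp (-(l * r)))
      + 1 / 43545600 * (l ^ 9 * Real.exp (-(l * r)))) (Ioi 0) :=
    ((integrableOn_pow_mul_exp_neg_mul_Ioi 3 hr).const_mul (1 / 144)).add
      ((integrableOn_pow_mul_exp_neg_mul_Ioi 9 hr).const_mul (1 / 43545600))
  refine (hsum.mono_set (Ioi_subset_Ioi hq)).congr_fun (fun l _ => ?_) measurableSet_Ioi
  ring

/-- **Laplace-side decay.** For `q ≥ 0` and `ζ > 0`,
`|∫_{λ > q} W(q, λ) e^{-λζ} dλ| ≤ (∫₀^∞ (λ³/144 + λ⁹/43545600) e^{-λζ/2} dλ) · e^{-qζ/2}`,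
`W(q, λ) = (λ²-q²)√(λ²-q²)/144 - (λ²-q²)⁴√(λ²-q²)/43545600`: dominate `|W(q, λ)|` by
`λ³/144 + λ⁹/43545600` (`abs_sliceWeight_le`), split `e^{-λζ} ≤ e^{-λζ/2} e^{-qζ/2}` on
`λ > q`, and enlarge `(q, ∞)` to `(0, ∞)` for the non-negative dominating integrand. [folklore] -/
theorem norm_integral_sliceWeight_mul_exp_le {q ζ : ℝ} (hq : 0 ≤ q) (hζ : 0 < ζ) :
    ‖∫ l in Ioi q, ((l ^ 2 - q ^ 2) * Real.sqrt (l ^ 2 - q ^ 2) / 144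
        - (l ^ 2 - q ^ 2) ^ 4 * Real.sqrt (l ^ 2 - q ^ 2) / 43545600) * Real.exp (-(l * ζ))‖ ≤
      (∫ l in Ioi (0 : ℝ), (l ^ 3 / 144 + l ^ 9 / 43545600) * Real.exp (-(l * (ζ / 2)))) *
        Real.exp (-(q * ζ / 2)) := by
  have hζ2 : 0 < ζ / 2 := by positivity
  have hdom0 := integrableOn_sliceDominant_mul_exp le_rfl hζ2
  have hdomq := integrableOn_sliceDominant_mul_exp hq hζ2
  calc ‖∫ l in Ioi q, ((l ^ 2 - q ^ 2) * Real.sqrt (l ^ 2 - q ^ 2) / 144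
          - (l ^ 2 - q ^ 2) ^ 4 * Real.sqrt (l ^ 2 - q ^ 2) / 43545600) * Real.exp (-(l * ζ))‖
        ≤ ∫ l in Ioi q, ‖((l ^ 2 - q ^ 2) * Real.sqrt (l ^ 2 - q ^ 2) / 144
            - (l ^ 2 - q ^ 2) ^ 4 * Real.sqrt (l ^ 2 - q ^ 2) / 43545600) *
              Real.exp (-(l * ζ))‖ :=
          norm_integral_le_integral_norm _
    _ ≤ ∫ l in Ioi q, (l ^ 3 / 144 + l ^ 9 / 43545600) * Real.exp (-(l * (ζ / 2))) *
          Real.exp (-(q * ζ / 2)) := by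
          refine setIntegral_mono_on (integrableOn_sliceWeight_mul_exp hq hζ).norm
            (hdomq.mul_const _) measurableSet_Ioi (fun l hl => ?_)
          rw [mem_Ioi] at hl
          have hl0 : 0 ≤ l := hq.trans hl.le
          rw [norm_mul, Real.norm_eq_abs, Real.norm_eq_abs, Real.abs_exp,
            mul_assoc (l ^ 3 / 144 + l ^ 9 / 43545600)]
          refine mul_le_mul (abs_sliceWeight_le hq hl.le) ?_ (Real.exp_pos _).le
            (by positivity)
          rw [← Real.exp_add]
          exact Real.exp_le_exp.2 (by nlinarith [mul_pos (sub_pos.2 hl) hζ])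
    _ = (∫ l in Ioi q, (l ^ 3 / 144 + l ^ 9 / 43545600) * Real.exp (-(l * (ζ / 2)))) *
          Real.exp (-(q * ζ / 2)) := integral_mul_const _ _
    _ ≤ (∫ l in Ioi (0 : ℝ), (l ^ 3 / 144 + l ^ 9 / 43545600) * Real.exp (-(l * (ζ / 2)))) *
          Real.exp (-(q * ζ / 2)) := by
          refine mul_le_mul_of_nonneg_right ?_ (Real.exp_pos _).le
          refine setIntegral_mono_set hdom0 ?_ (Ioi_subset_Ioi hq).eventuallyLE
          filter_upwards [ae_restrict_mem measurableSet_Ioi] with l hl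
          rw [mem_Ioi] at hl
          show (0 : ℝ) ≤ (l ^ 3 / 144 + l ^ 9 / 43545600) * Real.exp (-(l * (ζ / 2)))
          positivity

/-! ## The registered stub -/

/-- **Stub `fourier_ljCrossKernel_bound` — exponential decay of the planar Fourier transform of
the cross-plane Lennard-Jones kernel.** For a `2`-dimensional real inner-product space `V` and
`ζ > 0` there is `C = C(ζ)` with `‖𝓕[V_LJ(√(‖·‖² + ζ²))](w)‖ ≤ C e^{-πζ‖w‖}` for all `w ∈ V`;
explicitly `C = 2π ∫₀^∞ (λ³/144 + λ⁹/43545600) e^{-λζ/2} dλ = 2π (2/(3ζ⁴) + 128/(15ζ¹⁰))`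
works.  Proof: the Laplace form `fourier_ljCrossKernel` and the Laplace-side decay
`norm_integral_sliceWeight_mul_exp_le` at `q = 2π‖w‖`, where `e^{-qζ/2} = e^{-πζ‖w‖}`.
[folklore] -/
theorem fourier_ljCrossKernel_bound :
    ∀ (V : Type) [NormedAddCommGroup V] [InnerProductSpace ℝ V] [FiniteDimensional ℝ V]
      [MeasurableSpace V] [BorelSpace V],
      Module.finrank ℝ V = 2 →
      ∀ (ζ : ℝ), 0 < ζ → ∃ C : ℝ, ∀ w : V,
        ‖𝓕 (fun v : V => ((lennardJones (Real.sqrt (‖v‖ ^ 2 + ζ ^ 2)) : ℝ) : ℂ)) w‖ ≤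
          C * Real.exp (-(π * ζ * ‖w‖)) := by
  intro V _ _ _ _ _ hV ζ hζ
  refine ⟨2 * π *
    ∫ l in Ioi (0 : ℝ), (l ^ 3 / 144 + l ^ 9 / 43545600) * Real.exp (-(l * (ζ / 2))),
    fun w => ?_⟩
  obtain ⟨-, hF⟩ := fourier_ljCrossKernel V hV ζ w hζ
  rw [hF, Complex.norm_real, norm_mul, norm_neg,
    Real.norm_of_nonneg (by positivity : (0 : ℝ) ≤ 2 * π)]
  have key := norm_integral_sliceWeight_mul_exp_le (by positivity : (0 : ℝ) ≤ 2 * π * ‖w‖) hζ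
  rw [show -(2 * π * ‖w‖ * ζ / 2) = -(π * ζ * ‖w‖) by ring] at key
  exact (mul_le_mul_of_nonneg_left key (by positivity)).trans_eq (by ring)

end Summit.AtomisticToContinuum.Crystallization.Theorems.ChessboardParticlePlanesLjPlaneChessboard

end
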